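import Summits.QuantumFields.YangMills.Theorems.BalabanUVNodesN22W1StripNumerals
import Literature.MathematicalPhysics.QuantumFieldTheory.Balaban1983to89.Node00.RateRecordW1Reading

/-!
# BalabanUVNodes ∕ node N22 = NE9 — THE STRIP INDUCTION AT THE W1 OBJECT, MODULE 17′: THE NUMERALS AT EVERY BOND-CUBE PARAMETER `M` (A3 rider for the leaves of
# modules 15′ ∕ 16′, whose `M` is the record's `θ.τ9.M`, not the witness's `1`)

Cell `pub-ymgap`, HUMAN RULING D-0062 (Track A), R134 ACCELERATION re-seat `pub-ymgap-dag-n22-c` (strategy s1), generation 4, module 17′.  THEOREMS ONLY; imports module 4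
`…N22W1StripNumerals` (p466057: the 29 numeric clauses jointly satisfied at the tree's witness `B13Lemma3TorusNonvacuity.consts` with cube parameter `M = 1`) and
`Node00.RateRecordW1Reading` (`W1.LetterInputs`) BY NAME.  `--supports` K3′ (helper).

WHY.  The N22 leaves of modules 15′ ∕ 16′ (`s_N22_readingOfRecord₁₂_ofRecordAdm_runTowers…`) ask, per admissible Stage-12 tuple, for socket constants with
`Lemma3Numerics c θ.τ9.M (½c.L) …` AT THE RECORD's bond-cube parameter `θ.τ9.M` — module 4's witness is at `M = 1` only.  The parameter `M` enters the printed
restriction list in ONE clause, (2.31) p. 18 `2·4·M⁴·e^{−a/10} ≤ a/20`; every other clause containing the rate `a` is MONOTONE in `a` (R16, R16′, R17, the (2.29)∕(2.32)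
smallness `e^{−a/20}·64 ≤ δκ`, and — through `memberF c A = (L+2)⁴·A·ε₂`, increasing in `A = K₀(64,8)·e^{e^{−a/20}·64}` — R18half, R18sharp and the (2.38) bracket clause).
So the witness rate `aw` may be raised to `aw + 40·M`, absorbing `M⁴` by `M⁴e^{−4M} ≤ 1`.

WHAT.
* §1 `lemma3Numerics_consts_anyM` — `Lemma3Numerics consts M (½·consts.L) (aw + 40·M) 1 1 ½ 1` for EVERY `M : ℕ`.
* §2 `stripNumerics_nonvacuous_anyM` — module 4's `stripNumerics_nonvacuous` at every `M` (the S25 clauses and the renewal do not read `a`).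
* §3 ★ `leafNumerals_nonvacuous_anyM` — for every `M` and every window radius `γ`: letter inputs `li : W1.LetterInputs`, N09 letters `cs : SFConsts`, socket constants and
  socket letters satisfying SIMULTANEOUSLY the twelve signs `hnum` AND every numeric conjunct of the per-`(F, θ, k)` tuple of 15′ §4 ∕ 16′ §2b (`8 ≤ c.L`, `c.L = L`,
  `Lemma3Numerics c M (½c.L) …`, `0 ≤ C₃ε₁`, `0 ≤ r₁`, `li.κ ≤ r₁`, S25's two clauses, the renewal `e·9·64·K₀(64,8)²·C₃ε₁ ≤ li.A`, `γ ≤ cs.γ`, `li.κ ≤ cs.κ`) — so the leaves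
  are not vacuous in their numerals at ANY record size (the non-numeric conjuncts — the `hspk` inclusion, `h226TOnOlder` ∕ the generator schemas, the `EHoloAt` family — are
  nodes N10 ∕ N09's content and the reading's, untouched).

HONEST FRAMING.  Count-neutral CONSISTENCY WITNESS for the numerals as typed (witness constants = the tree's `consts`, `L = 8`, `E₀ = 2`, rate `aw + 40M`; letters
`li = (κ := consts.κ, θ₅ := ½, C₅ := 0, cr := 0, ρ := 0, C₀ := 1, A := 2, μ := 1, r := 1, s := ½)`; they are NOT the record's constants and certify nothing about
Bałaban's regime); NOT a discharge of N22; NE9 NOT IN PRINT; one finite four-torus programme at fixed ε — NOT infinite volume, NOT OS on ℝ⁴, NOT a mass gap, NOT Clay.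
0 `sorry`, 0 `def`, standard axioms.

References (TYPES only): [II] = [Balaban1988RG2Cluster] pp. 17–21 (restrictions on the constants; (2.31) p. 18; p. 20 before (2.37)), R23 p. 21, closing paragraph p. 21.
-/

noncomputable section

namespace YMDAG.N22.W1

open Set Metric
open scoped BigOperators
open Literature.MathematicalPhysics.QuantumFieldTheory.Balaban1983to89
open Literature.MathematicalPhysics.QuantumFieldTheory.Balaban1983to89.B12TreeDecay (K₀ K₀_pos)
open Literature.MathematicalPhysics.QuantumFieldTheory.Balaban1983to89.B13Lemma3TorusSocket (Lemma3Numerics)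
open Literature.MathematicalPhysics.QuantumFieldTheory.Balaban1983to89.B13Lemma3WindowNonvacuity (aw)
open Literature.MathematicalPhysics.QuantumFieldTheory.Balaban1983to89.B13Lemma3TorusNonvacuity (consts numerics_nonvacuous_pos_consts consts_L)
open Literature.MathematicalPhysics.QuantumFieldTheory.Balaban1983to89.B13Step237 (memberF bracketF R18half R18sharp)
open Literature.MathematicalPhysics.QuantumFieldTheory.Balaban1983to89.Step (SFConsts)
open Literature.MathematicalPhysics.QuantumFieldTheory.Balaban1983to89.Node00.W1 (LetterInputs)

/-! ## §1 The socket's printed restriction list at every bond-cube parameter -/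

/-- `M⁴·e^{−4M} ≤ 1` for every natural `M` (`M ≤ e^{M}`). [folklore] -/
private theorem pow_four_mul_exp_neg_le_one (M : ℕ) : (M : ℝ) ^ 4 * Real.exp (-(4 * (M : ℝ))) ≤ 1 := by
  have hM : (0 : ℝ) ≤ M := Nat.cast_nonneg M
  have h1 : (M : ℝ) * Real.exp (-(M : ℝ)) ≤ 1 := by
    have h := Real.add_one_le_exp (M : ℝ)
    have hpos := Real.exp_pos (-(M : ℝ))
    calc (M : ℝ) * Real.exp (-(M : ℝ)) ≤ Real.exp (M : ℝ) * Real.exp (-(M : ℝ)) := mul_le_mul_of_nonneg_right (by linarith) hpos.le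
      _ = 1 := by rw [← Real.exp_add, add_neg_cancel, Real.exp_zero]
  have h0 : 0 ≤ (M : ℝ) * Real.exp (-(M : ℝ)) := mul_nonneg hM (Real.exp_pos _).le
  calc (M : ℝ) ^ 4 * Real.exp (-(4 * (M : ℝ))) = ((M : ℝ) * Real.exp (-(M : ℝ))) ^ 4 := by
        rw [mul_pow, ← Real.exp_nat_mul]; norm_num
    _ ≤ 1 ^ 4 := pow_le_pow_left₀ h0 h1 4
    _ = 1 := one_pow 4

/-- The per-member constant `memberF c A = (L+2)⁴·A·ε₂` is monotone in its O(1) argument (`0 ≤ ε₂`). [cite: Balaban1988RG2Cluster, p.20 (before (2.37))] -/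
private theorem memberF_mono {A B : ℝ} (h : A ≤ B) : memberF consts A ≤ memberF consts B := by
  obtain ⟨-, -, -, -, heps2, -⟩ := numerics_nonvacuous_pos_consts
  unfold memberF
  exact mul_le_mul_of_nonneg_right (mul_le_mul_of_nonneg_left h (by positivity)) heps2

/-- **THE PRINTED RESTRICTIONS R15–R18, R20, (2.29)∕(2.31)∕(2.32), (2.38) AT EVERY BOND-CUBE PARAMETER `M`**, at the tree's witness constants `consts` (`L = 8`) with the
rate RAISED to `aw + 40·M` and socket letters `a₂ = a₂′ = 1`, `a₅ = ½`, `Aabs = 1`: `Lemma3Numerics consts M (½·consts.L) (aw + 40M) 1 1 ½ 1`.  The only `M`-dependent clause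
is (2.31); every other `a`-clause is monotone in `a`. [cite: Balaban1988RG2Cluster, (2.31) p.18 and p.21 (closing paragraph)] -/
theorem lemma3Numerics_consts_anyM (M : ℕ) : Lemma3Numerics consts M ((consts.L : ℝ) / 2) (aw + 40 * (M : ℝ)) 1 1 (1 / 2) 1 := by
  obtain ⟨-, -, -, hα₆, heps2, hδ, hδ7, hκ, ha, hR15, hR16, hR16', hR17, h231, ha₂, hκ229, hsm229, habsk, h18half, h18, ha₂', hκ229', hsm229',
    hR20, ha₅, habs, hAc, hC3, -⟩ := numerics_nonvacuous_pos_consts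
  have hM : (0 : ℝ) ≤ M := Nat.cast_nonneg M
  have haM : aw ≤ aw + 40 * (M : ℝ) := le_add_of_nonneg_right (by positivity)
  have hexp20 : Real.exp (-((aw + 40 * (M : ℝ)) / 20)) ≤ Real.exp (-(aw / 20)) := Real.exp_le_exp.2 (by linarith)
  have hX : K₀ 64 8 * Real.exp (Real.exp (-((aw + 40 * (M : ℝ)) / 20)) * 64) ≤ K₀ 64 8 * Real.exp (Real.exp (-(aw / 20)) * 64) :=
    mul_le_mul_of_nonneg_left (Real.exp_le_exp.2 (mul_le_mul_of_nonneg_right hexp20 (by norm_num))) (K₀_pos _ _).le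
  have hmem := memberF_mono hX
  have hℓ : (0 : ℝ) ≤ (consts.L : ℝ) / 2 := by positivity
  refine ⟨hℓ, hα₆, heps2, hδ, hδ7, hκ, ha.trans haM, hR15, hR16.trans (by linarith), hR16'.trans (by linarith), hexp20.trans hR17, ?_, ha₂, hκ229,
    hsm229, (mul_le_mul_of_nonneg_right hexp20 (by norm_num)).trans habsk, hmem.trans h18half, ?_, ha₂', hκ229', hsm229', hR20, ha₅, habs, hAc, ?_⟩
  · -- (2.31) at `M`: `2·4·M⁴·e^{−(aw+40M)/10} = (2·4·e^{−aw/10})·(M⁴e^{−4M}) ≤ aw/20 ≤ (aw + 40M)/20`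
    have h1 : 2 * (4 : ℝ) * ((1 : ℕ) : ℝ) ^ 4 * Real.exp (-(aw / 10)) ≤ aw / 20 := h231
    simp only [Nat.cast_one, one_pow, mul_one] at h1
    have hsplit : Real.exp (-((aw + 40 * (M : ℝ)) / 10)) = Real.exp (-(aw / 10)) * Real.exp (-(4 * (M : ℝ))) := by
      rw [← Real.exp_add]; congr 1; ring
    have h8 : 0 ≤ 2 * (4 : ℝ) * Real.exp (-(aw / 10)) := by positivity
    calc 2 * (4 : ℝ) * (M : ℝ) ^ 4 * Real.exp (-((aw + 40 * (M : ℝ)) / 10))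
        = 2 * (4 : ℝ) * Real.exp (-(aw / 10)) * ((M : ℝ) ^ 4 * Real.exp (-(4 * (M : ℝ)))) := by rw [hsplit]; ring
      _ ≤ 2 * (4 : ℝ) * Real.exp (-(aw / 10)) * 1 := mul_le_mul_of_nonneg_left (pow_four_mul_exp_neg_le_one M) h8
      _ ≤ aw / 20 := by rw [mul_one]; exact h1
      _ ≤ (aw + 40 * (M : ℝ)) / 20 := by linarith
  · -- R18sharp: `bracketF = 2·memberF` is monotone in the O(1) argument
    unfold R18sharp at h18 ⊢
    refine le_trans (mul_le_mul_of_nonneg_right ?_ (Real.exp_pos _).le) h18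
    unfold bracketF
    linarith
  · -- the (2.38) bracket clause: monotone likewise (`0 < α₆`)
    refine le_trans ?_ hC3
    refine mul_le_mul_of_nonneg_right (div_le_div_of_nonneg_right ?_ hα₆.le) (Real.exp_pos _).le
    unfold bracketF
    linarith

/-! ## §2 Module 4's `∃`-packaging at every `M` -/

/-- **THE NUMERALS OF MODULES 1–3 ∕ 14′ ARE JOINTLY SATISFIABLE AT EVERY BOND-CUBE PARAMETER `M`**: constants `c` (the tree's `consts`), block factor `L = c.L = 8`,
socket letters and (1.18)∕S25 letters `(E₀, κ, r₁) = (c.E₀, c.κ, c.κ)` satisfying every numeric hypothesis of the producer chain simultaneously — module 4's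
`stripNumerics_nonvacuous` with `M` universally quantified. [cite: Balaban1988RG2Cluster, p.21 (closing paragraph)] -/
theorem stripNumerics_nonvacuous_anyM (M : ℕ) :
    ∃ (c : B13.Consts) (L : ℕ) (a a₂ a₂' a₅ Aabs E₀ κ r₁ : ℝ), 0 < L ∧ 8 ≤ c.L ∧ c.L = L ∧
      Lemma3Numerics c M ((c.L : ℝ) / 2) a a₂ a₂' a₅ Aabs ∧ 0 ≤ c.C3act * c.ε₁ ∧ 0 ≤ r₁ ∧ κ ≤ r₁ ∧
      r₁ + 2 * (64 * Real.log 162) + 2 ≤ (1 - 8 * c.δ) * ((c.L : ℝ) / 2) * c.κ ∧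
      c.C3act * c.ε₁ * Real.exp (5 * r₁ + 1) * K₀ 64 8 * 9 * 64 ≤ 1 ∧ Real.exp 1 * 9 * 64 * K₀ 64 8 ^ 2 * (c.C3act * c.ε₁) ≤ E₀ ∧
      κ = c.κ ∧ E₀ = c.E₀ := by
  obtain ⟨hL, -, hC3pos, hκ, hκr, hlarge, hsmall, hrenew⟩ := stripNumerics_consts
  exact ⟨consts, consts.L, aw + 40 * (M : ℝ), 1, 1, 1 / 2, 1, consts.E₀, consts.κ, consts.κ, by omega, hL, rfl, lemma3Numerics_consts_anyM M, hC3pos, hκ,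
    hκr, hlarge, hsmall, hrenew, rfl, rfl⟩

/-! ## §3 The leaves' numeric conjuncts at every record size -/

/-- **THE N22 LEAVES OF MODULES 15′ ∕ 16′ ARE NOT VACUOUS IN THEIR NUMERALS AT ANY RECORD SIZE** (A3 rider).  For every bond-cube parameter `M` and every window radius
`γ` there are letter inputs `li`, N09 letters `cs`, socket constants `c`, a block factor `L` and socket letters such that the twelve signs of `hnum` hold AND every numeric
conjunct of the per-`(F, θ, k)` tuple of `s_N22_readingOfRecord₁₂_ofRecordAdm_runTowers_of_s_N18_termwise226OnOlder_eHoloAt` ∕ `…_toClusterTower_of_s_N18_stepSchemas_eHoloAt`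
holds at `M`: `8 ≤ c.L`, `c.L = L`, `Lemma3Numerics c M (½c.L) …`, `0 ≤ C₃ε₁`, `0 ≤ r₁`, `li.κ ≤ r₁`, S25's two clauses, the renewal `e·9·64·K₀(64,8)²·C₃ε₁ ≤ li.A`,
`γ ≤ cs.γ`, `li.κ ≤ cs.κ`.  Witness: `li := (consts.κ, ½, 0, 0, 0, 1, consts.E₀, 1, 1, ½)`, `cs := (consts.κ, 1, γ, 0, …, 0)`, §2's constants. [cite: Balaban1988RG2Cluster, p.21 (closing paragraph)] -/
theorem leafNumerals_nonvacuous_anyM (M : ℕ) (γ : ℝ) :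
    ∃ (li : LetterInputs) (cs : SFConsts) (c : B13.Consts) (L : ℕ) (a a₂ a₂' a₅ Aabs r₁ : ℝ),
      (0 < li.C₀ ∧ 0 < li.θ₅ ∧ li.θ₅ < 1 ∧ 0 ≤ li.C₅ ∧ 2 * li.C₅ / (1 - li.θ₅) ≤ li.C₀ ∧ 0 < li.A ∧ li.θ₅ ≤ li.μ ∧ li.C₀ ≤ 2 * li.A ∧ 0 < li.r ∧
        0 < li.s ∧ li.s < 1 ∧ 1 ≤ li.μ) ∧
      8 ≤ c.L ∧ c.L = L ∧ Lemma3Numerics c M ((c.L : ℝ) / 2) a a₂ a₂' a₅ Aabs ∧ 0 ≤ c.C3act * c.ε₁ ∧ 0 ≤ r₁ ∧ li.κ ≤ r₁ ∧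
      r₁ + 2 * (64 * Real.log 162) + 2 ≤ (1 - 8 * c.δ) * ((c.L : ℝ) / 2) * c.κ ∧
      c.C3act * c.ε₁ * Real.exp (5 * r₁ + 1) * K₀ 64 8 * 9 * 64 ≤ 1 ∧
      Real.exp 1 * 9 * 64 * K₀ 64 8 ^ 2 * (c.C3act * c.ε₁) ≤ li.A ∧ γ ≤ cs.γ ∧ li.κ ≤ cs.κ := by
  obtain ⟨hL, -, hC3pos, hκ, hκr, hlarge, hsmall, hrenew⟩ := stripNumerics_consts
  have hE₀ : consts.E₀ = 2 := rfl
  refine ⟨⟨consts.κ, 1 / 2, 0, 0, 0, 1, consts.E₀, 1, 1, 1 / 2⟩, ⟨consts.κ, 1, γ, 0, 0, 0, 0, 0, 0, 0⟩, consts, consts.L, aw + 40 * (M : ℝ), 1, 1, 1 / 2, 1,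
    consts.κ, ?_, hL, rfl, lemma3Numerics_consts_anyM M, hC3pos, hκ, hκr, hlarge, hsmall, hrenew, le_rfl, le_rfl⟩
  refine ⟨by norm_num, by norm_num, by norm_num, le_rfl, by norm_num, by rw [hE₀]; norm_num, by norm_num, by rw [hE₀]; norm_num, by norm_num, by norm_num,
    by norm_num, le_rfl⟩

end YMDAG.N22.W1

end
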